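import Mathlib
import HarnessLib
import Literature.Analysis.FluidPDE.HarmonicAnalyticContinuation
import Summits.NavierStokesRegularity.NavierStokesRegularity.Theorems.PoloidalWindowDoorPoloidalWindowRigidityWindow
import Summits.NavierStokesRegularity.NavierStokesRegularity.Theorems.RellichScarScarRigidityApexRegularity
import Summits.NavierStokesRegularity.NavierStokesRegularity.Theorems.RellichScarSymmetricScarExistsApexRieszPressureBounds
import Summits.NavierStokesRegularity.NavierStokesRegularity.Theorems.LocalHelicityTubeDoorFrobeniusProfileRigidityBernoulliWindow
import Summits.NavierStokesRegularity.NavierStokesRegularity.Theorems.PlaneStrainDoorProfileWindowToSlab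

/-!
# Door family `LocalPressureProfileDoor` (nsreg-p1 ROUND-16) — the ONE-WINDOW identity member, profile side I:
# the support `PressureWindowToSlab` — slice analyticity of the pressure GRADIENT and window → slab

Cell ns-regularity-ideate, seat `ns-pressure-K2-p1` (LEAD lineage of the closed crux K2⁺ stmt-NavierStokesRegularity-20180;
THEOREMS-ONLY sequel, no route, no item — ROUND-16 §4 Day 3 «S17 follows once the two supports are kitted»).

The route `LocalPressureProfileDoor` closed the ONE-SIDED door S17⁺ (`Theses.LocalPressureProfileDoor.Target`: asymptotically
non-increasing similarity pressure at EVERY similarity position ⇒ backward bounded) through the crux K2⁺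
`MonotonePressureProfileRigidity` (`…Theorems.LocalPressureProfileDoorMonotonePressureProfileRigidity.monotonePressureProfileRigidity_proof`).
Its sibling S17 — the IDENTITY member read on ONE nonempty open similarity window — needed the support
`PressureWindowToSlab` of the cell sketch (r16/Sketch17.lean), whose suggested proof was «slice analyticity of `v(t)` passes to
`Q[v(t)]` by analytic elliptic regularity of `ΔQ = −∂ᵢ∂ⱼ(vᵢvⱼ)`».  This file proves the support WITHOUT elliptic analytic
regularity, for a profile `v` of the door class (space–time Type-I decay `D`, continuous on the open backward slab,
unit-viscosity Oseen–Duhamel identity, divergence-free slices; `Q = pressurePotential`, the Riesz pressure `RᵢRⱼ(vᵢvⱼ)`):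

* `isClassicalNSSolutionOn_rieszPressure_of_class` — `(v, Q[v])` is a classical Navier–Stokes solution on the open slab
  (tree: `isTypeIAncientMild_of_class`, `RellichScarScarRigidity.exists_isClassicalNSSolutionOn_Iio` /
  `isClassicalNSSolutionOn_rieszPressure`);
* `gradient_pressurePotential_eq` — hence `∇Q[v(t)] = Δv(t) − ∂ₜv(t) − (v(t)·∇)v(t)` pointwise (the momentum equation);
* `analyticOnNhd_gradient_pressurePotential_slice` / `analyticOnNhd_fderiv_pressurePotential_slice` — so `y ↦ ∇Q[v(t)](y)` is
  REAL-ANALYTIC on `ℝ³` for every `t < 0`: the right-hand side is, by the joint real-analyticity of Oseen-ancient fields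
  (`analyticOnNhd_uncurry`, Lemarié-Rieusset Thm 9.12 in the tree) — `analyticOnNhd_laplacian`, `analyticOnNhd_timeDeriv_slice`,
  `analyticOnNhd_clm_apply`;
* `eq_of_isOpen_of_fderiv_analyticOnNhd` — a differentiable scalar with real-analytic derivative that is constant on a
  nonempty open set is constant (identity theorem for the derivative + mean value);
* `abs_profilePressure_le` — the scale-invariant decay `|(−t)Q[v(t)](√(−t)y)| ≤ K/(‖y‖+1)²` of the similarity pressure
  (`SymmetricScarExists.LogtimeBernoulli.apexRieszPressure_scaleInvariantBounds`);
* `profilePressure_sub_eq_zero_of_isOpen` — **window → slab**: if the difference of two similarity-pressure slices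
  `y ↦ (−t₁)Q[v(t₁)](√(−t₁)y) − (−t₂)Q[v(t₂)](√(−t₂)y)` is constant on a nonempty open set, it vanishes identically
  (constant everywhere by the previous two items, and it tends to `0` at spatial infinity).

This file is route-independent (no `Theses` import).  The profile crux in window form (`pressureWindowRigidity`, by the closed K2⁺)
and the door itself (zoom side, by K1 `LocalPointZoomSimilarityPressure_proof`) are the sequel file `…LocalPressureProfileDoorWindowTarget`.

WHAT THIS IS NOT: not a claim about Navier–Stokes regularity (Clay A), not a Type-I Liouville theorem (hard core 10661 untouched):
the profile side of a CONDITIONAL door (bears_on LADDER-NS N0, rung N0-LocalTubeDoorPressureProfile, sequel; evades the hard cores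
by hypothesis).
-/

noncomputable section

-- the summit and its single sub-problem share the name (CONVENTIONS §1), as in every Theorems file
set_option linter.dupNamespace false

namespace Summit.NavierStokesRegularity.NavierStokesRegularity.Theorems.LocalPressureProfileDoorPressureWindowToSlab

open MeasureTheory Set Function Filter Topology TopologicalSpace Metric InnerProductSpace
open scoped RealInnerProductSpace InnerProductSpace Laplacian ContDiff
open Literature.Analysis Literature.Analysis.FluidPDE
open Summit.NavierStokesRegularity.NavierStokesRegularity.Theorems.LocalSineTubeDoorProfileAlignedWindowRigidityAncient
open Summit.NavierStokesRegularity.NavierStokesRegularity.Theorems.PoloidalWindowDoorPoloidalWindowRigidityWindow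
open Summit.NavierStokesRegularity.NavierStokesRegularity.Theorems.RellichScarScarRigidity
  (exists_isClassicalNSSolutionOn_Iio isClassicalNSSolutionOn_rieszPressure)
open Summit.NavierStokesRegularity.NavierStokesRegularity.Theorems.SymmetricScarExists.LogtimeBernoulli
  (apexRieszPressure_scaleInvariantBounds)
open Summit.NavierStokesRegularity.NavierStokesRegularity.Theorems.LocalHelicityTubeDoorFrobeniusProfileRigidityBernoulliWindow
  (analyticOnNhd_timeDeriv_slice)
open Summit.NavierStokesRegularity.NavierStokesRegularity.Theorems.PlaneStrainDoorProfileWindowToSlab (analyticOnNhd_clm_apply)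

variable {D : ℝ} {v : ℝ → EuclideanSpace ℝ (Fin 3) → EuclideanSpace ℝ (Fin 3)}

/-! ### The Riesz pressure of a door-class profile is classical; the gradient identity -/

/-- **`(v, Q[v])` is a classical Navier–Stokes solution on the open backward slab** for a profile of the door class
(space–time Type-I decay, continuity on the open slab, unit-viscosity Oseen–Duhamel identity, divergence-free slices):
class membership `isTypeIAncientMild_of_class` (the Oseen–Duhamel identity is consumed here), a jointly smooth classical
pressure on the whole slab (`exists_isClassicalNSSolutionOn_Iio`, Fabes–Jones–Rivière glued), and the decaying gauge
`∇q = ∇Q[v]` with `Q[v]` jointly smooth (`isClassicalNSSolutionOn_rieszPressure`). -/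
theorem isClassicalNSSolutionOn_rieszPressure_of_class (hdecay : HasTypeIDecay D v)
    (hcont : ContinuousOn (uncurry v) (Iio (0 : ℝ) ×ˢ univ))
    (hmild : ∀ s t : ℝ, s < t → t < 0 → ∀ x,
      v t x = UnboundedOperators.heatExtension (v s) (t - s) x - oseenDuhamel 1 s v v t x)
    (hdiv : ∀ t < 0, VectorCalculus.IsDivFree (v t)) :
    IsClassicalNSSolutionOn (Iio (0 : ℝ)) 1 0 v (fun t x => pressurePotential (v t) x) := by
  have hD0 : 0 ≤ D := nonneg_of_hasTypeIDecay hdecay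
  have hA : IsTypeIAncientMild D v := isTypeIAncientMild_of_class (hdecay.hasTypeITimeDecay hD0) hcont hmild hdiv
  obtain ⟨q, hq⟩ := exists_isClassicalNSSolutionOn_Iio hA
  exact isClassicalNSSolutionOn_rieszPressure hq hdecay

/-- **The gradient of the Riesz pressure from the momentum equation**: for a classical solution `(v, Q[v])` of
Navier–Stokes (`ν = 1`, `f = 0`) on the open slab, `∇Q[v(t)](x) = Δv(t)(x) − ∂ₜv(t, x) − (v(t)·∇)v(t)(x)` for `t < 0`
(two-sided time derivative, the slab being open). -/
theorem gradient_pressurePotential_eq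
    (hcl : IsClassicalNSSolutionOn (Iio (0 : ℝ)) 1 0 v (fun t x => pressurePotential (v t) x))
    {t : ℝ} (ht : t < 0) (x : EuclideanSpace ℝ (Fin 3)) :
    gradient (pressurePotential (v t)) x = (Δ (v t)) x - deriv (fun τ => v τ x) t - convect (v t) (v t) x := by
  have h := hcl.momentum t ht x
  rw [timeDerivWithin_apply, derivWithin_of_isOpen isOpen_Iio ht, one_smul] at h
  simp only [Pi.zero_apply, add_zero] at h
  have h2 : gradient (pressurePotential (v t)) x = (Δ (v t)) x - (deriv (fun τ => v τ x) t + convect (v t) (v t) x) := by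
    rw [h]
    show gradient (pressurePotential (v t)) x = (Δ (v t)) x - ((Δ (v t)) x - gradient (fun x => pressurePotential (v t) x) x)
    abel
  rw [h2]
  abel

/-! ### Slice analyticity of the pressure GRADIENT -/

/-- **The gradient of the Riesz pressure of a slice is real-analytic.**  For a profile of the door class and `t < 0`,
`x ↦ ∇Q[v(t)](x)` is real-analytic on `ℝ³`: by `gradient_pressurePotential_eq` it is `Δv(t) − ∂ₜv(t) − (v(t)·∇)v(t)`, and
each term is real-analytic by the joint real-analyticity of Oseen-ancient fields (slice: `analyticOnNhd_slice`; Laplacian: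
`analyticOnNhd_laplacian`; time derivative: `analyticOnNhd_timeDeriv_slice`; convective term: `analyticOnNhd_clm_apply`).
No elliptic analytic regularity for `ΔQ = −∂ᵢ∂ⱼ(vᵢvⱼ)` is used. -/
theorem analyticOnNhd_gradient_pressurePotential_slice (hdecay : HasTypeIDecay D v)
    (hcont : ContinuousOn (uncurry v) (Iio (0 : ℝ) ×ˢ univ))
    (hmild : ∀ s t : ℝ, s < t → t < 0 → ∀ x,
      v t x = UnboundedOperators.heatExtension (v s) (t - s) x - oseenDuhamel 1 s v v t x)
    (hdiv : ∀ t < 0, VectorCalculus.IsDivFree (v t)) {t : ℝ} (ht : t < 0) :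
    AnalyticOnNhd ℝ (fun x => gradient (pressurePotential (v t)) x) univ := by
  have hD0 : 0 ≤ D := nonneg_of_hasTypeIDecay hdecay
  have hrate : HasTypeITimeDecay D v := hdecay.hasTypeITimeDecay hD0
  have hcl := isClassicalNSSolutionOn_rieszPressure_of_class hdecay hcont hmild hdiv
  have hslice : AnalyticOnNhd ℝ (v t) univ := analyticOnNhd_slice hcont (bdd_of_hasTypeITimeDecay hrate) hmild ht
  have hlap : AnalyticOnNhd ℝ (Δ (v t)) univ := analyticOnNhd_laplacian hslice
  have hdt : AnalyticOnNhd ℝ (fun y => deriv (fun τ => v τ y) t) univ :=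
    analyticOnNhd_timeDeriv_slice hcont (bdd_of_hasTypeITimeDecay hrate) hmild ht
  have hconv : AnalyticOnNhd ℝ (fun y => convect (v t) (v t) y) univ := analyticOnNhd_clm_apply hslice.fderiv hslice
  have key : (fun x => gradient (pressurePotential (v t)) x) =
      fun x => (Δ (v t)) x - deriv (fun τ => v τ x) t - convect (v t) (v t) x :=
    funext fun x => gradient_pressurePotential_eq hcl ht x
  rw [key]
  exact (hlap.sub hdt).sub hconv

/-- **The derivative of the Riesz pressure of a slice is real-analytic** (`DQ = toDual ∘ ∇Q`). -/
theorem analyticOnNhd_fderiv_pressurePotential_slice (hdecay : HasTypeIDecay D v)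
    (hcont : ContinuousOn (uncurry v) (Iio (0 : ℝ) ×ˢ univ))
    (hmild : ∀ s t : ℝ, s < t → t < 0 → ∀ x,
      v t x = UnboundedOperators.heatExtension (v s) (t - s) x - oseenDuhamel 1 s v v t x)
    (hdiv : ∀ t < 0, VectorCalculus.IsDivFree (v t)) {t : ℝ} (ht : t < 0) :
    AnalyticOnNhd ℝ (fderiv ℝ (pressurePotential (v t))) univ := by
  have h := analyticOnNhd_gradient_pressurePotential_slice hdecay hcont hmild hdiv ht
  have h2 := (InnerProductSpace.toDual ℝ (EuclideanSpace ℝ (Fin 3))).toLinearIsometry.toContinuousLinearMap.comp_analyticOnNhd h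
  refine h2.congr isOpen_univ (fun x _ => ?_)
  simp only [Function.comp_apply, LinearIsometry.coe_toContinuousLinearMap, LinearIsometryEquiv.coe_toLinearIsometry,
    gradient, LinearIsometryEquiv.apply_symm_apply]

/-! ### The similarity-pressure slices `y ↦ (−t)·Q[v(t)](√(−t) y)`: derivative, analyticity, decay -/

/-- **Chain rule for a similarity-pressure slice**: `y ↦ (−t)Q[v(t)](√(−t)y)` has derivative
`((−t)√(−t)) • DQ[v(t)](√(−t)y)` everywhere (the slice `Q[v(t)]` is smooth). -/
theorem hasFDerivAt_profilePressure
    (hcl : IsClassicalNSSolutionOn (Iio (0 : ℝ)) 1 0 v (fun t x => pressurePotential (v t) x))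
    {t : ℝ} (ht : t < 0) (y : EuclideanSpace ℝ (Fin 3)) :
    HasFDerivAt (fun y : EuclideanSpace ℝ (Fin 3) => (-t) * pressurePotential (v t) (Real.sqrt (-t) • y))
      (((-t) * Real.sqrt (-t)) • fderiv ℝ (pressurePotential (v t)) (Real.sqrt (-t) • y)) y := by
  have hQ1 : ContDiff ℝ 1 (pressurePotential (v t)) := (hcl.contDiff_pressure ht).of_le (by norm_cast)
  have hQ : Differentiable ℝ (pressurePotential (v t)) := hQ1.differentiable one_ne_zero
  have h1 : HasFDerivAt (fun y : EuclideanSpace ℝ (Fin 3) => Real.sqrt (-t) • y)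
      (Real.sqrt (-t) • ContinuousLinearMap.id ℝ (EuclideanSpace ℝ (Fin 3))) y :=
    (hasFDerivAt_id y).const_smul (Real.sqrt (-t))
  have h2 : HasFDerivAt (pressurePotential (v t)) (fderiv ℝ (pressurePotential (v t)) (Real.sqrt (-t) • y))
      (Real.sqrt (-t) • y) := (hQ _).hasFDerivAt
  have h3 : HasFDerivAt (fun y : EuclideanSpace ℝ (Fin 3) => pressurePotential (v t) (Real.sqrt (-t) • y))
      ((fderiv ℝ (pressurePotential (v t)) (Real.sqrt (-t) • y)).comp
        (Real.sqrt (-t) • ContinuousLinearMap.id ℝ (EuclideanSpace ℝ (Fin 3)))) y := h2.comp y h1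
  refine (h3.const_mul (-t)).congr_fderiv ?_
  ext w
  simp only [smul_apply, ContinuousLinearMap.comp_apply, ContinuousLinearMap.id_apply, map_smul, smul_eq_mul]
  ring

/-- **The derivative of a similarity-pressure slice is real-analytic**, and the slice is differentiable. -/
theorem differentiable_and_analyticOnNhd_fderiv_profilePressure (hdecay : HasTypeIDecay D v)
    (hcont : ContinuousOn (uncurry v) (Iio (0 : ℝ) ×ˢ univ))
    (hmild : ∀ s t : ℝ, s < t → t < 0 → ∀ x,
      v t x = UnboundedOperators.heatExtension (v s) (t - s) x - oseenDuhamel 1 s v v t x)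
    (hdiv : ∀ t < 0, VectorCalculus.IsDivFree (v t)) {t : ℝ} (ht : t < 0) :
    Differentiable ℝ (fun y : EuclideanSpace ℝ (Fin 3) => (-t) * pressurePotential (v t) (Real.sqrt (-t) • y)) ∧
    AnalyticOnNhd ℝ
      (fderiv ℝ (fun y : EuclideanSpace ℝ (Fin 3) => (-t) * pressurePotential (v t) (Real.sqrt (-t) • y))) univ := by
  have hcl := isClassicalNSSolutionOn_rieszPressure_of_class hdecay hcont hmild hdiv
  have hder := fun y => hasFDerivAt_profilePressure hcl ht y
  refine ⟨fun y => (hder y).differentiableAt, ?_⟩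
  have e : fderiv ℝ (fun y : EuclideanSpace ℝ (Fin 3) => (-t) * pressurePotential (v t) (Real.sqrt (-t) • y)) =
      ((-t) * Real.sqrt (-t)) • fun y => fderiv ℝ (pressurePotential (v t)) (Real.sqrt (-t) • y) :=
    funext fun y => (hder y).fderiv
  rw [e]
  refine AnalyticOnNhd.const_smul (fun y _ => ?_)
  exact ((analyticOnNhd_fderiv_pressurePotential_slice hdecay hcont hmild hdiv ht) (Real.sqrt (-t) • y) (mem_univ _)).comp
    (analyticAt_const.fun_smul analyticAt_id)

/-- **Scale-invariant decay of the similarity pressure**: there is `K = K(D) ≥ 0` with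
`|(−t)Q[v(t)](√(−t)y)| ≤ K/(‖y‖+1)²` for all `t < 0`, `y` (from `(‖x‖+√(−t))²|Q[v(t)](x)| ≤ K`,
`apexRieszPressure_scaleInvariantBounds`, at `x = √(−t)y`). -/
theorem abs_profilePressure_le (hdecay : HasTypeIDecay D v)
    (hcont : ContinuousOn (uncurry v) (Iio (0 : ℝ) ×ˢ univ))
    (hmild : ∀ s t : ℝ, s < t → t < 0 → ∀ x,
      v t x = UnboundedOperators.heatExtension (v s) (t - s) x - oseenDuhamel 1 s v v t x)
    (hdiv : ∀ t < 0, VectorCalculus.IsDivFree (v t)) :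
    ∃ K : ℝ, 0 ≤ K ∧ ∀ t < (0 : ℝ), ∀ y : EuclideanSpace ℝ (Fin 3),
      |(-t) * pressurePotential (v t) (Real.sqrt (-t) • y)| ≤ K / (‖y‖ + 1) ^ 2 := by
  have hcl := isClassicalNSSolutionOn_rieszPressure_of_class hdecay hcont hmild hdiv
  obtain ⟨K, hK0, hK⟩ := apexRieszPressure_scaleInvariantBounds D
  refine ⟨K, hK0, fun t ht y => ?_⟩
  have hs : 0 < Real.sqrt (-t) := Real.sqrt_pos.2 (neg_pos.2 ht)
  have hnt : 0 < -t := neg_pos.2 ht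
  have h := (hK v _ hcl hdecay t ht (Real.sqrt (-t) • y)).1
  have hnorm : ‖Real.sqrt (-t) • y‖ + Real.sqrt (-t) = Real.sqrt (-t) * (‖y‖ + 1) := by
    rw [norm_smul, Real.norm_of_nonneg hs.le]; ring
  rw [hnorm, mul_pow, Real.sq_sqrt hnt.le] at h
  have hpos : 0 < (‖y‖ + 1) ^ 2 := by positivity
  rw [le_div_iff₀ hpos, abs_mul, abs_of_pos hnt]
  calc -t * |pressurePotential (v t) (Real.sqrt (-t) • y)| * (‖y‖ + 1) ^ 2
      = -t * (‖y‖ + 1) ^ 2 * |pressurePotential (v t) (Real.sqrt (-t) • y)| := by ring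
    _ ≤ K := h

/-! ### Window → slab -/

/-- **A differentiable scalar with real-analytic derivative which is constant on a nonempty open set is constant**:
its derivative vanishes on the open set, hence everywhere (identity theorem on the connected `ℝ³`), and the mean value
theorem concludes. -/
theorem eq_of_isOpen_of_fderiv_analyticOnNhd {H : EuclideanSpace ℝ (Fin 3) → ℝ} (hH : Differentiable ℝ H)
    (hDH : AnalyticOnNhd ℝ (fderiv ℝ H) univ) {U : Set (EuclideanSpace ℝ (Fin 3))} (hU : IsOpen U)
    {y₀ : EuclideanSpace ℝ (Fin 3)} (hy₀ : y₀ ∈ U) (hc : ∀ y ∈ U, H y = H y₀) :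
    ∀ y, H y = H y₀ := by
  have hzero : ∀ y ∈ U, fderiv ℝ H y = 0 := by
    intro y hy
    have hev : H =ᶠ[𝓝 y] fun _ => H y₀ := Filter.eventually_of_mem (hU.mem_nhds hy) fun z hz => hc z hz
    rw [hev.fderiv_eq, fderiv_const_apply]
  have hev0 : fderiv ℝ H =ᶠ[𝓝 y₀] 0 := Filter.eventually_of_mem (hU.mem_nhds hy₀) fun z hz => hzero z hz
  have hall : ∀ y, fderiv ℝ H y = 0 := fun y =>
    hDH.eqOn_zero_of_preconnected_of_eventuallyEq_zero isPreconnected_univ (mem_univ y₀) hev0 (mem_univ y)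
  exact fun y => is_const_of_fderiv_eq_zero hH hall y y₀

/-- **WINDOW → SLAB for similarity-pressure slices** (the support `PressureWindowToSlab` of the cell sketch, value form).
For a profile of the door class and `t₁, t₂ < 0`: if the difference of the similarity-pressure slices
`y ↦ (−t₁)Q[v(t₁)](√(−t₁)y) − (−t₂)Q[v(t₂)](√(−t₂)y)` takes the same value at all points of a nonempty open set, then it
vanishes identically on `ℝ³` — it is constant everywhere (`eq_of_isOpen_of_fderiv_analyticOnNhd`, the derivative being
real-analytic by `differentiable_and_analyticOnNhd_fderiv_profilePressure`) and tends to `0` at spatial infinity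
(`abs_profilePressure_le`). -/
theorem profilePressure_sub_eq_zero_of_isOpen (hdecay : HasTypeIDecay D v)
    (hcont : ContinuousOn (uncurry v) (Iio (0 : ℝ) ×ˢ univ))
    (hmild : ∀ s t : ℝ, s < t → t < 0 → ∀ x,
      v t x = UnboundedOperators.heatExtension (v s) (t - s) x - oseenDuhamel 1 s v v t x)
    (hdiv : ∀ t < 0, VectorCalculus.IsDivFree (v t)) {t₁ t₂ : ℝ} (ht₁ : t₁ < 0) (ht₂ : t₂ < 0)
    {U : Set (EuclideanSpace ℝ (Fin 3))} (hU : IsOpen U) (hne : U.Nonempty)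
    (hwin : ∀ y ∈ U, ∀ y' ∈ U,
      (-t₁) * pressurePotential (v t₁) (Real.sqrt (-t₁) • y) - (-t₂) * pressurePotential (v t₂) (Real.sqrt (-t₂) • y) =
      (-t₁) * pressurePotential (v t₁) (Real.sqrt (-t₁) • y') - (-t₂) * pressurePotential (v t₂) (Real.sqrt (-t₂) • y')) :
    ∀ y : EuclideanSpace ℝ (Fin 3),
      (-t₁) * pressurePotential (v t₁) (Real.sqrt (-t₁) • y) - (-t₂) * pressurePotential (v t₂) (Real.sqrt (-t₂) • y) = 0 := by
  obtain ⟨y₀, hy₀⟩ := hne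
  set H : EuclideanSpace ℝ (Fin 3) → ℝ := fun y =>
    (-t₁) * pressurePotential (v t₁) (Real.sqrt (-t₁) • y) - (-t₂) * pressurePotential (v t₂) (Real.sqrt (-t₂) • y) with hH
  obtain ⟨hd₁, ha₁⟩ := differentiable_and_analyticOnNhd_fderiv_profilePressure hdecay hcont hmild hdiv ht₁
  obtain ⟨hd₂, ha₂⟩ := differentiable_and_analyticOnNhd_fderiv_profilePressure hdecay hcont hmild hdiv ht₂
  have hHd : Differentiable ℝ H := hd₁.sub hd₂
  have hHD : AnalyticOnNhd ℝ (fderiv ℝ H) univ := by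
    have e : fderiv ℝ H = fun y =>
        fderiv ℝ (fun y : EuclideanSpace ℝ (Fin 3) => (-t₁) * pressurePotential (v t₁) (Real.sqrt (-t₁) • y)) y -
        fderiv ℝ (fun y : EuclideanSpace ℝ (Fin 3) => (-t₂) * pressurePotential (v t₂) (Real.sqrt (-t₂) • y)) y :=
      funext fun y => fderiv_sub (hd₁ y) (hd₂ y)
    rw [e]
    exact ha₁.sub ha₂
  -- constant on `U`, hence everywhere
  have hconst : ∀ y, H y = H y₀ :=
    eq_of_isOpen_of_fderiv_analyticOnNhd hHd hHD hU hy₀ (fun y hy => hwin y hy y₀ hy₀)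
  -- the constant vanishes: `H → 0` at spatial infinity
  obtain ⟨K, hK0, hK⟩ := abs_profilePressure_le hdecay hcont hmild hdiv
  have hbound : ∀ y : EuclideanSpace ℝ (Fin 3), |H y₀| ≤ 2 * K / (‖y‖ + 1) ^ 2 := by
    intro y
    rw [← hconst y]
    have h1 := hK t₁ ht₁ y
    have h2 := hK t₂ ht₂ y
    calc |H y| ≤ |(-t₁) * pressurePotential (v t₁) (Real.sqrt (-t₁) • y)| +
          |(-t₂) * pressurePotential (v t₂) (Real.sqrt (-t₂) • y)| := abs_sub _ _
      _ ≤ K / (‖y‖ + 1) ^ 2 + K / (‖y‖ + 1) ^ 2 := add_le_add h1 h2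
      _ = 2 * K / (‖y‖ + 1) ^ 2 := by ring
  have hzero : H y₀ = 0 := by
    -- along points `yₙ` with `‖yₙ‖ = n` the bound tends to `0`
    have h0 : Tendsto (fun n : ℕ => ((n : ℝ) + 1) ^ 2) atTop atTop :=
      (tendsto_pow_atTop two_ne_zero).comp (tendsto_atTop_add_const_right _ _ tendsto_natCast_atTop_atTop)
    have hlim : Tendsto (fun n : ℕ => 2 * K * (((n : ℝ) + 1) ^ 2)⁻¹) atTop (𝓝 0) := by
      simpa using h0.inv_tendsto_atTop.const_mul (2 * K)
    have hle : |H y₀| ≤ 0 :=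
      ge_of_tendsto' hlim fun n => by
        obtain ⟨y, hy⟩ := exists_norm_eq (EuclideanSpace ℝ (Fin 3)) (Nat.cast_nonneg n : (0 : ℝ) ≤ n)
        have h := hbound y
        rwa [hy, div_eq_mul_inv] at h
    exact abs_nonpos_iff.1 hle
  intro y
  have := hconst y
  rw [hzero] at this
  exact this

end Summit.NavierStokesRegularity.NavierStokesRegularity.Theorems.LocalPressureProfileDoorPressureWindowToSlab

end
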